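import Mathlib
import HarnessLib

/-!
# The band vanishing lemma (Lemma A)

(Line `janus-bands`, crux `ArrangementNormalForm`, stub `stub_separateTwoZero` — separation in a
good rational direction for PLANAR arrangement representations without fibres; part `Vanish`.)

If `F = (∑_{i<N} Qᵢ(u) λ^i)/G · λ^{-n}` is absolutely integrable on a band `I × (0, η)` along the
line `λ = 0` (`|G| ≤ C`, `G ≠ 0`, `Qᵢ` continuous), then `Qᵢ = 0` on `I` for `i < n`
(`band_vanish`): Tonelli, the one-variable fact that a polynomial times `t^{-n}` is integrable at
`0⁺` only if its coefficients of degree `< n` vanish (`coeff_eq_zero_of_integrableOn`,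
registered as `separateTwoZero_vanish`), and "open + null ⟹ empty".
-/

noncomputable section

open Set MeasureTheory Filter Topology
open scoped ENNReal

namespace Summit.KontsevichZagierPeriods.ArrangementNormalForm.JanusBands

namespace SepTwoZero

/-- `t⁻¹` is not integrable at `0⁺`. -/
theorem inv_not_integrableOn_Ioo {δ : ℝ} (hδ : 0 < δ) :
    ¬ IntegrableOn (fun t : ℝ => t⁻¹) (Ioo 0 δ) := by
  intro h
  have h' : IntegrableOn (fun t : ℝ => t ^ (-1 : ℝ)) (Ioo 0 δ) :=
    h.congr_fun (fun t _ => by rw [Real.rpow_neg_one]) measurableSet_Ioo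
  have := (intervalIntegral.integrableOn_Ioo_rpow_iff hδ).1 h'
  norm_num at this

/-- **One-variable vanishing lemma.** If `(∑_{m<N} c_m t^m) · t^{-n}` is integrable at `0⁺`,
then `c_m = 0` for `m < n`. -/
theorem coeff_eq_zero_of_integrableOn (n : ℕ) :
    ∀ (c : ℕ → ℝ) (N : ℕ) {η : ℝ}, 0 < η →
      IntegrableOn (fun t : ℝ => (∑ m ∈ Finset.range N, c m * t ^ m) * (1 / t) ^ n) (Ioo 0 η) →
      ∀ m, m < n → m < N → c m = 0 := by
  induction n with
  | zero => intro c N η _ _ m hm; exact absurd hm (Nat.not_lt_zero m)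
  | succ n ih =>
    intro c N η hη hint
    -- step 1: the constant coefficient vanishes
    have h0 : ∀ (h0N : 0 < N), c 0 = 0 := by
      intro h0N
      by_contra hc0
      set g : ℝ → ℝ := fun t => ∑ m ∈ Finset.range N, c m * t ^ m with hg
      have hgc : Continuous g := by fun_prop
      have hg0 : g 0 = c 0 := by
        rw [hg]; simp only
        rw [Finset.sum_eq_single 0 (fun m _ hm => by simp [hm]) (fun h => absurd
          (Finset.mem_range.2 h0N) h)]
        simp
      -- |g t| ≥ |c 0|/2 near 0
      have hev : ∀ᶠ t in 𝓝 (0 : ℝ), |c 0| / 2 < |g t| := by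
        have : Tendsto (fun t => |g t|) (𝓝 0) (𝓝 |c 0|) := by
          rw [← hg0]; exact hgc.abs.tendsto 0
        exact this.eventually_const_lt (by linarith [abs_pos.2 hc0])
      obtain ⟨ρ, hρ, hρb⟩ := Metric.eventually_nhds_iff.1 hev
      set δ := min (min ρ η) 1 with hδ
      have hδpos : 0 < δ := by positivity
      have hsub : Ioo 0 δ ⊆ Ioo 0 η := Ioo_subset_Ioo le_rfl
        ((min_le_left _ _).trans (min_le_right _ _))
      have hint' : IntegrableOn (fun t : ℝ => g t * (1 / t) ^ (n + 1)) (Ioo 0 δ) :=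
        hint.mono_set hsub
      refine inv_not_integrableOn_Ioo hδpos ?_
      refine Integrable.mono' (hint'.norm.const_mul (2 / |c 0|)) ?_ ?_
      · exact (continuousOn_inv₀.mono fun t ht => ne_of_gt ht.1).aestronglyMeasurable
          measurableSet_Ioo
      · refine (ae_restrict_iff' measurableSet_Ioo).2 (Eventually.of_forall fun t ht => ?_)
        have ht0 : 0 < t := ht.1
        have ht1 : t ≤ 1 := ht.2.le.trans (min_le_right _ _)
        have htρ : t < ρ := ht.2.trans_le ((min_le_left _ _).trans (min_le_left _ _))
        have hgt : |c 0| / 2 < |g t| := hρb (by simpa [abs_of_pos ht0] using htρ)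
        rw [Real.norm_eq_abs, Real.norm_eq_abs, abs_mul, abs_inv, abs_of_pos ht0, abs_pow,
          one_div, abs_inv, abs_of_pos ht0]
        have hc0' : 0 < |c 0| := abs_pos.2 hc0
        have h1 : t⁻¹ ≤ (t⁻¹) ^ (n + 1) := by
          calc t⁻¹ = (t⁻¹) ^ 1 := (pow_one _).symm
            _ ≤ (t⁻¹) ^ (n + 1) := pow_le_pow_right₀ (one_le_inv₀ ht0 |>.2 ht1) (by omega)
        calc t⁻¹ ≤ 1 * (t⁻¹) ^ (n + 1) := by rw [one_mul]; exact h1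
          _ ≤ (2 / |c 0| * |g t|) * (t⁻¹) ^ (n + 1) := by
              refine mul_le_mul_of_nonneg_right ?_ (by positivity)
              rw [div_mul_eq_mul_div, le_div_iff₀ hc0']; linarith
          _ = 2 / |c 0| * (|g t| * (t⁻¹) ^ (n + 1)) := by ring
    -- step 2: factor `t` and use the induction hypothesis
    intro m hm hmN
    rcases Nat.eq_zero_or_pos m with rfl | hmpos
    · exact h0 hmN
    · have hN : 0 < N := lt_of_le_of_lt (Nat.zero_le _) hmN
      have hc0 := h0 hN
      -- shifted coefficients
      have key : IntegrableOn (fun t : ℝ => (∑ m ∈ Finset.range (N - 1), c (m + 1) * t ^ m) *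
          (1 / t) ^ n) (Ioo 0 η) := by
        refine hint.congr_fun (fun t ht => ?_) measurableSet_Ioo
        have ht : t ≠ 0 := ne_of_gt ht.1
        have hsum : ∑ m ∈ Finset.range N, c m * t ^ m =
            t * ∑ m ∈ Finset.range (N - 1), c (m + 1) * t ^ m := by
          obtain ⟨N', rfl⟩ : ∃ N', N = N' + 1 := ⟨N - 1, by omega⟩
          rw [Finset.sum_range_succ', hc0, Nat.add_sub_cancel, Finset.mul_sum]
          simp only [zero_mul, add_zero, pow_succ]
          exact Finset.sum_congr rfl fun i _ => by ring
        show (∑ m ∈ Finset.range N, c m * t ^ m) * (1 / t) ^ (n + 1) = _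
        rw [hsum, pow_succ]
        field_simp
      have := ih (fun m => c (m + 1)) (N - 1) hη key (m - 1) (by omega) (by omega)
      rwa [Nat.sub_add_cancel hmpos] at this

/-- The one-variable vanishing lemma on either side of `0`. -/
theorem coeff_eq_zero_of_integrableOn_side (n : ℕ) (c : ℕ → ℝ) (N : ℕ) {η : ℝ} (hη : 0 < η)
    {J : Set ℝ} (hJ : J = Ioo 0 η ∨ J = Ioo (-η) 0)
    (h : IntegrableOn (fun t : ℝ => (∑ m ∈ Finset.range N, c m * t ^ m) * (1 / t) ^ n) J) :
    ∀ m, m < n → m < N → c m = 0 := by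
  rcases hJ with rfl | rfl
  · exact coeff_eq_zero_of_integrableOn n c N hη h
  · intro m hm hmN
    have hpre : (Neg.neg : ℝ → ℝ) ⁻¹' Ioo (-η) 0 = Ioo 0 η := by
      ext t; simp [and_comm]
    have h2 := ((Measure.measurePreserving_neg (volume : Measure ℝ)).integrableOn_comp_preimage
      (Homeomorph.neg ℝ).measurableEmbedding).2 h
    rw [hpre] at h2
    have h3 : IntegrableOn (fun t : ℝ => (∑ m ∈ Finset.range N, (c m * (-1) ^ m) * t ^ m) *
        (1 / t) ^ n) (Ioo 0 η) := by
      refine IntegrableOn.congr_fun (h2.const_mul ((-1) ^ n)) (fun t _ => ?_) measurableSet_Ioo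
      simp only [Function.comp_apply]
      have h4 : ∀ m, c m * (-t) ^ m = c m * (-1) ^ m * t ^ m := fun m => by
        rw [neg_pow]; ring
      simp only [h4]
      rw [show (1 / -t) = (-1) * (1 / t) by ring, mul_pow]
      have h5 : ((-1 : ℝ) ^ n) * (-1) ^ n = 1 := by
        rw [← mul_pow]; simp
      linear_combination (∑ m ∈ Finset.range N, c m * (-1) ^ m * t ^ m) * (1 / t) ^ n * h5
    have := coeff_eq_zero_of_integrableOn n _ N hη h3 m hm hmN
    simpa using this

/-- **Band vanishing lemma (Lemma A).** On a band `I × J` along the line `λ = 0`, if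
`F = (∑_{i<N} Qᵢ(u) λ^i)/G · λ^{-n}` is absolutely integrable with `|G| ≤ C`, `G ≠ 0`, then the
continuous coefficients `Qᵢ`, `i < n`, vanish on `I`. -/
theorem band_vanish {N n : ℕ} (Q : ℕ → ℝ → ℝ) (hQ : ∀ i, Continuous (Q i)) {ρ₁ ρ₂ η : ℝ}
    (hη : 0 < η) {J : Set ℝ} (hJ : J = Ioo 0 η ∨ J = Ioo (-η) 0)
    (G : ℝ × ℝ → ℝ) (C : ℝ) (hGb : ∀ w ∈ Ioo ρ₁ ρ₂ ×ˢ J, |G w| ≤ C)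
    (hG0 : ∀ w ∈ Ioo ρ₁ ρ₂ ×ˢ J, G w ≠ 0) (F : ℝ × ℝ → ℝ)
    (hF : IntegrableOn F (Ioo ρ₁ ρ₂ ×ˢ J))
    (hFeq : EqOn F (fun w => (∑ i ∈ Finset.range N, Q i w.1 * w.2 ^ i) / G w * (1 / w.2) ^ n)
      (Ioo ρ₁ ρ₂ ×ˢ J)) :
    ∀ i, i < n → i < N → ∀ u ∈ Ioo ρ₁ ρ₂, Q i u = 0 := by
  have hJm : MeasurableSet J := by rcases hJ with rfl | rfl <;> exact measurableSet_Ioo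
  have hJo : IsOpen J := by rcases hJ with rfl | rfl <;> exact isOpen_Ioo
  -- Tonelli: a.e. fibre is integrable
  have h1 : ∀ᵐ u ∂(volume.restrict (Ioo ρ₁ ρ₂)), Integrable (fun t => F (u, t))
      (volume.restrict J) := by
    have hF' : Integrable F ((volume.restrict (Ioo ρ₁ ρ₂)).prod (volume.restrict J)) := by
      rw [Measure.prod_restrict, ← Measure.volume_eq_prod]; exact hF
    exact hF'.prod_right_ae
  -- on a.e. fibre, the low coefficients vanish
  have h2 : ∀ᵐ u ∂(volume.restrict (Ioo ρ₁ ρ₂)), u ∈ Ioo ρ₁ ρ₂ →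
      ∀ i, i < n → i < N → Q i u = 0 := by
    filter_upwards [h1] with u hu huI i hi hiN
    refine coeff_eq_zero_of_integrableOn_side n (fun m => Q m u) N hη hJ ?_ i hi hiN
    refine Integrable.mono' (hu.norm.const_mul C) ?_ ?_
    · refine ContinuousOn.aestronglyMeasurable (fun t ht => ?_) hJm
      have ht0 : t ≠ 0 := by
        rcases hJ with rfl | rfl
        · exact ne_of_gt ht.1
        · exact ne_of_lt ht.2
      exact ContinuousAt.continuousWithinAt (by fun_prop (disch := exact ht0))
    · refine (ae_restrict_iff' hJm).2 (Eventually.of_forall fun t ht => ?_)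
      have hw : (u, t) ∈ Ioo ρ₁ ρ₂ ×ˢ J := ⟨huI, ht⟩
      have hG := hG0 _ hw
      rw [Real.norm_eq_abs, Real.norm_eq_abs, hFeq hw]
      have : (∑ m ∈ Finset.range N, Q m u * t ^ m) * (1 / t) ^ n =
          ((∑ i ∈ Finset.range N, Q i u * t ^ i) / G (u, t) * (1 / t) ^ n) * G (u, t) := by
        field_simp
      rw [this, abs_mul, mul_comm C]
      exact mul_le_mul_of_nonneg_left (hGb _ hw) (abs_nonneg _)
  -- the exceptional set is open and null, hence empty
  set B := {u | u ∈ Ioo ρ₁ ρ₂ ∧ ∃ i, i < n ∧ i < N ∧ Q i u ≠ 0} with hB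
  have hBnull : volume B = 0 := by
    have h3 : volume.restrict (Ioo ρ₁ ρ₂) {u | ¬ (u ∈ Ioo ρ₁ ρ₂ →
        ∀ i, i < n → i < N → Q i u = 0)} = 0 := ae_iff.1 h2
    have hBsub : B ⊆ {u | ¬ (u ∈ Ioo ρ₁ ρ₂ → ∀ i, i < n → i < N → Q i u = 0)} := by
      rintro u ⟨hu, i, hi, hiN, hq⟩ h
      exact hq (h hu i hi hiN)
    have h4 : volume.restrict (Ioo ρ₁ ρ₂) B = 0 := measure_mono_null hBsub h3
    rw [Measure.restrict_apply' measurableSet_Ioo] at h4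
    rwa [inter_eq_left.2 (fun u hu => hu.1)] at h4
  have hBopen : IsOpen B := by
    have : B = Ioo ρ₁ ρ₂ ∩ ⋃ i ∈ Finset.range (min n N), {u | Q i u ≠ 0} := by
      ext u
      simp only [hB, mem_setOf_eq, mem_inter_iff, mem_iUnion, Finset.mem_range, lt_min_iff,
        exists_prop, ne_eq]
      constructor
      · rintro ⟨hu, i, hi, hiN, hq⟩; exact ⟨hu, i, ⟨hi, hiN⟩, hq⟩
      · rintro ⟨hu, i, ⟨hi, hiN⟩, hq⟩; exact ⟨hu, i, hi, hiN, hq⟩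
    rw [this]
    exact isOpen_Ioo.inter (isOpen_biUnion fun i _ => isOpen_ne_fun (hQ i) continuous_const)
  have hBempty : B = ∅ := by
    by_contra hne
    have := hBopen.measure_pos volume (nonempty_iff_ne_empty.2 hne)
    rw [hBnull] at this
    exact lt_irrefl _ this
  intro i hi hiN u hu
  by_contra hq
  have : u ∈ B := ⟨hu, i, hi, hiN, hq⟩
  rw [hBempty] at this
  exact this

end SepTwoZero

open SepTwoZero in
/-- **One-variable vanishing lemma** (registered sub-goal of `stub_separateTwoZero`): if `(∑_{m<N} c_m t^m) · t^{-n}` is integrable at `0⁺`, then `c_m = 0` for `m < n`. -/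
theorem separateTwoZero_vanish (n : ℕ) (c : ℕ → ℝ) (N : ℕ) (η : ℝ) (hη : 0 < η) (h : MeasureTheory.IntegrableOn (fun t : ℝ => (∑ m ∈ Finset.range N, c m * t ^ m) * (1 / t) ^ n) (Set.Ioo 0 η)) (m : ℕ) (hm : m < n) (hmN : m < N) : c m = 0 := by
  exact coeff_eq_zero_of_integrableOn n c N hη h m hm hmN

end Summit.KontsevichZagierPeriods.ArrangementNormalForm.JanusBands
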